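import Literature.Probability.LatticeModels.DobrushinShlosmanSuperSolutionInfiniteVolume
import HarnessLib

/-!
# The Dobrushin–Shlosman window comparison under the per-window received sum: covariance decay of every Gibbs
# measure at the GEOMETRIC rate, and the comparison of two specifications WITH DEFECTS (Gibbs pairs)

Topic `Literature/Probability/LatticeModels`; theorems only. Measure-level consequences of
`DobrushinShlosmanSuperSolutionInfiniteVolume.lean` (Föllmer 1988 Ch. I (2.7)–(2.11), Thm. (2.8), Thm. (2.13), in
Dobrushin–Shlosman's window setting, under the PER-WINDOW received sum `Σ_{y ∈ nbhd c} K c y x ≤ γ₀ < 1`):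

* `abs_covariance_le_of_window_geometric` — for EVERY Gibbs measure `μ` of `γ` and bounded measurable `f, g` reading
  finite `Δf, Δg` with site-Lipschitz vectors, given the two-set profile of `abs_covariance_le_of_window` (depth `L₀` on
  `Δf`): `|cov_μ(f, g)| ≤ 2 R² γ₀^{L₀} (Σ δf)(Σ δg)` — the tilt trick of `abs_covariance_le_of_window` verbatim, closing with
  `abs_sub_le_of_window_geometric_exp`; compare `4 R² e^{−(1−γ₀)² L₀/(2(2γ₀N⋆+1))}` there.
* `abs_integral_sub_integral_le_of_window_pair_defect` — TWO specifications `γ, γ'` whose window kernels at the usable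
  centres differ, on observables with site-Lipschitz vector `δ`, by at most `Σ_{x ∈ win c} κ c x δ x` (a DEFECT array
  `κ ≥ 0`; `κ = 0` where they agree), `μ ∈ G(γ)`, `ν ∈ G(γ')`, and a nonnegative super-solution `d` of the window
  system of `γ` with the defects ((S1) `Σ_y K c y x d y + κ c x ≤ d x` on usable windows, (S2) `d ≥ R` on the sites of
  `Λ` in no usable window): `|∫ f dμ − ∫ f dν| ≤ Σ_{x ∈ Δf} d x δf x` — Föllmer's comparison theorem (2.8) with the
  localised defect (2.10) for window kernels: the estimate is LINEAR in the size of the defect and decays along any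
  profile the super-solution encodes.
* `abs_integral_sub_integral_le_of_window_pair_geometric` — the defect-free case (kernels agree at the usable centres):
  `|∫ f dμ − ∫ f dν| ≤ R γ₀^{L₀} Σ δf`.

References: H. Föllmer, LNM 1362 (1988), Ch. I, (2.7)–(2.11), Thm. (2.8), Thm. (2.13); R. L. Dobrushin, S. B. Shlosman
(1985), Thm. 1; H.-O. Georgii (2011) §8.2; the tree files `DobrushinShlosmanInfiniteVolume.lean` (the covariance proof,
followed line by line), `DobrushinShlosmanGibbsPair.lean`.
-/

noncomputable section

open MeasureTheory ProbabilityTheory Finset Function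
open Literature.Probability.LatticeModels.DobrushinMetric (IsLipBound integrable_of_abs_le'
  abs_sub_le_mul_sum_of_dependsOn)

namespace Literature.Probability.LatticeModels.DobrushinShlosman

variable {V S : Type*} [MeasurableSpace S]

/-! ### Covariance decay at the geometric rate -/

/-- **Covariance decay under the per-window Dobrushin–Shlosman condition, GEOMETRIC rate, every Gibbs measure,
arbitrary index set** (Föllmer 1988 Ch. I Thm. (2.13) / Georgii 2011 §8.2 tilt trick on top of
`abs_sub_le_of_window_geometric_exp`): window data and profile hypotheses exactly as in `abs_covariance_le_of_window`
(without the bound `N⋆` on the number of windows through a site), per-window received sum `≤ γ₀ < 1`. Then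
`|cov_μ(f, g)| ≤ 2 R² γ₀^{L₀} (Σ_{Δf} δf)(Σ_{Δg} δg)`. [cite: Follmer1988, Ch. I Theorem (2.13)] -/
theorem abs_covariance_le_of_window_geometric [DecidableEq V] {γ : Specification V S} (hγ : IsSpecification γ)
    {r : S → S → ℝ} {R : ℝ} (hr0 : ∀ a b, 0 ≤ r a b) (hrR : ∀ a b, r a b ≤ R) (hR : 0 ≤ R)
    {win nbhd : V → Finset V} {K : V → V → V → ℝ} (hK0 : ∀ c y x, 0 ≤ K c y x)
    (hself : ∀ c, c ∈ win c) (hwin : ∀ c, win c ⊆ nbhd c)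
    (hKsupp : ∀ c y x, K c y x ≠ 0 → y ∈ nbhd c)
    (hcontract : ∀ (c y : V), y ∉ win c → ∀ (ω η : V → S), (∀ v, v ≠ y → ω v = η v) →
      ∀ (f : (V → S) → ℝ) (δ : V → ℝ), Measurable f → (∃ B, ∀ σ, |f σ| ≤ B) →
        DependsOn f (win c : Set V) → (∀ x, 0 ≤ δ x) →
        (∀ (x : V) (σ τ : V → S), (∀ v, v ≠ x → σ v = τ v) → |f σ - f τ| ≤ δ x * r (σ x) (τ x)) →
          |∫ σ, f σ ∂(γ (win c) ω) - ∫ σ, f σ ∂(γ (win c) η)| ≤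
            (∑ x ∈ win c, K c y x * δ x) * r (ω y) (η y))
    (hloc : ∀ (c : V) (ζ ζ' : V → S), (∀ v ∈ nbhd c, ζ v = ζ' v) →
      ∀ (f : (V → S) → ℝ), Measurable f → (∃ B, ∀ σ, |f σ| ≤ B) → DependsOn f (win c : Set V) →
        ∫ σ, f σ ∂(γ (win c) ζ) = ∫ σ, f σ ∂(γ (win c) ζ'))
    {γ₀ : ℝ} (hγ₀ : 0 ≤ γ₀) (hγ₁ : γ₀ < 1)
    (hsum : ∀ c, ∀ x ∈ win c, ∑ y ∈ nbhd c, K c y x ≤ γ₀)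
    {μ : Measure (V → S)} (hμ : IsGibbsMeasure γ μ) {f g : (V → S) → ℝ} (hfm : Measurable f)
    (hgm : Measurable g) {Bf Bg : ℝ} (hBf : ∀ σ, |f σ| ≤ Bf) (hBg : ∀ σ, |g σ| ≤ Bg)
    {Δf Δg : Finset V} (hfdep : DependsOn f (Δf : Set V)) (hgdep : DependsOn g (Δg : Set V))
    {δf δg : V → ℝ} (hδf : IsLipBound r f δf) (hδg : IsLipBound r g δg)
    (Λ : Finset V) (hΔf : Δf ⊆ Λ) (ℓ : V → ℕ) (L₀ : ℕ)
    (hU : ∀ x, ℓ x ≠ 0 → ∀ c, x ∈ win c → c ∈ Λ ∧ nbhd c ⊆ Λ ∧ ∀ z ∈ win c, z ∉ Δg)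
    (hℓ : ∀ c x y, x ∈ win c → K c y x ≠ 0 → ℓ x ≤ ℓ y + 1) (hL : ∀ x ∈ Δf, L₀ ≤ ℓ x) :
    |cov[f, g; μ]| ≤ 2 * R ^ 2 * γ₀ ^ L₀ * (∑ x ∈ Δf, δf x) * ∑ y ∈ Δg, δg y := by
  -- adapted from `DobrushinShlosman.abs_covariance_le_of_window` (closing with the geometric comparison)
  classical
  haveI := hμ.isProbabilityMeasure
  obtain ⟨τ₀, -⟩ := nonempty_of_measure_ne_zero (μ := μ) (s := Set.univ) (by simp)
  -- the shifted density `g̃ ∈ [0, 2 S_g]`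
  set Sg : ℝ := R * ∑ y ∈ Δg, δg y with hSg
  have hSg0 : 0 ≤ Sg := mul_nonneg hR (Finset.sum_nonneg fun y _ => hδg.nonneg y)
  have hosc : ∀ σ, |g σ - g τ₀| ≤ Sg := fun σ => abs_sub_le_mul_sum_of_dependsOn hrR hgdep hδg σ τ₀
  set gt : (V → S) → ℝ := fun σ => g σ + (Sg - g τ₀) with hgt
  have hgt0 : ∀ σ, 0 ≤ gt σ := fun σ => by
    have := (abs_le.1 (hosc σ)).1; simp only [hgt]; linarith
  have hgtB : ∀ σ, gt σ ≤ 2 * Sg := fun σ => by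
    have := (abs_le.1 (hosc σ)).2; simp only [hgt]; linarith
  have hgtm : Measurable gt := hgm.add_const _
  have hgtdep : DependsOn gt (Δg : Set V) := fun σ τ h => by
    simp only [hgt]; rw [hgdep h]
  have hgi : Integrable g μ := integrable_of_abs_le' hgm hBg
  have hfi : Integrable f μ := integrable_of_abs_le' hfm hBf
  have hgtabs : ∀ σ, |gt σ| ≤ 2 * Sg := fun σ => by
    rw [abs_of_nonneg (hgt0 σ)]; exact hgtB σ
  have hgti : Integrable gt μ := integrable_of_abs_le' hgtm hgtabs
  -- the right-hand side is nonnegative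
  have hRHS : 0 ≤ 2 * R ^ 2 * γ₀ ^ L₀ * (∑ x ∈ Δf, δf x) * ∑ y ∈ Δg, δg y := by
    have := Finset.sum_nonneg fun x (_ : x ∈ Δf) => hδf.nonneg x
    have := Finset.sum_nonneg fun y (_ : y ∈ Δg) => hδg.nonneg y
    have := pow_nonneg hγ₀ L₀
    positivity
  -- `cov(f, g) = cov(f, g̃) = μ(f g̃) - μ(f) μ(g̃)`
  have hcov : cov[f, g; μ] = ∫ σ, f σ * gt σ ∂μ - (∫ σ, f σ ∂μ) * ∫ σ, gt σ ∂μ := by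
    have h1 : cov[f, g; μ] = cov[f, gt; μ] := by
      rw [hgt, covariance_add_const_right hgi]
    rw [h1, covariance_eq_sub]
    · rfl
    · exact memLp_of_bounded (a := -Bf) (b := Bf)
        (ae_of_all _ fun σ => abs_le.1 (hBf σ)) hfm.aestronglyMeasurable 2
    · exact memLp_of_bounded (a := -(2 * Sg)) (b := 2 * Sg)
        (ae_of_all _ fun σ => abs_le.1 (hgtabs σ)) hgtm.aestronglyMeasurable 2
  by_cases hz : ∫ σ, gt σ ∂μ = 0
  · -- degenerate case: `g̃ = 0` a.e., so the covariance vanishes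
    have hae : gt =ᵐ[μ] 0 := (integral_eq_zero_iff_of_nonneg (fun σ => hgt0 σ) hgti).1 hz
    have hfg : ∫ σ, f σ * gt σ ∂μ = 0 := by
      rw [← integral_zero (α := V → S) (μ := μ) (G := ℝ)]
      refine integral_congr_ae ?_
      filter_upwards [hae] with σ hσ
      simp [hσ]
    rw [hcov, hfg, hz, mul_zero, sub_zero, abs_zero]
    exact hRHS
  have hpos : 0 < ∫ σ, gt σ ∂μ := lt_of_le_of_ne (integral_nonneg hgt0) (Ne.symm hz)
  -- the two functionals: `μ` and its tilt by `g̃`; usable = windows inside `Λ` avoiding `Δg`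
  have hgfi : ∀ {F : (V → S) → ℝ}, Measurable F → ∀ {B : ℝ}, (∀ σ, |F σ| ≤ B) →
      Integrable (fun σ => gt σ * F σ) μ := fun hFm B hB =>
    hgti.mul_bdd hFm.aestronglyMeasurable (ae_of_all _ fun σ => by rw [Real.norm_eq_abs]; exact hB σ)
  have h₁le : ∀ ⦃F : (V → S) → ℝ⦄ ⦃M : ℝ⦄, Measurable F → (∃ B, ∀ σ, |F σ| ≤ B) →
      DependsOn F (Λ : Set V) → (∀ σ, F σ ≤ M) → ∫ σ, F σ ∂μ ≤ M := by
    rintro F M hFm ⟨B, hB⟩ - hM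
    calc ∫ σ, F σ ∂μ ≤ ∫ _σ, M ∂μ := integral_mono (integrable_of_abs_le' hFm hB) (integrable_const M) hM
      _ = M := by simp
  have h₁ge : ∀ ⦃F : (V → S) → ℝ⦄ ⦃M : ℝ⦄, Measurable F → (∃ B, ∀ σ, |F σ| ≤ B) →
      DependsOn F (Λ : Set V) → (∀ σ, M ≤ F σ) → M ≤ ∫ σ, F σ ∂μ := by
    rintro F M hFm ⟨B, hB⟩ - hM
    calc M = ∫ _σ, M ∂μ := by simp
      _ ≤ ∫ σ, F σ ∂μ := integral_mono (integrable_const M) (integrable_of_abs_le' hFm hB) hM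
  have h₁T : ∀ c, c ∈ Λ → nbhd c ⊆ Λ → (∀ z ∈ win c, z ∉ Δg) → ∀ ⦃F : (V → S) → ℝ⦄, Measurable F →
      (∃ B, ∀ σ, |F σ| ≤ B) → DependsOn F (Λ : Set V) →
        ∫ σ, (fun σ => ∫ τ, F τ ∂(γ (win c) σ)) σ ∂μ = ∫ σ, F σ ∂μ := by
    rintro c - - - F hFm ⟨B, hB⟩ -
    exact hμ.integral_integral_eq hγ (win c) (integrable_of_abs_le' hFm hB)
  have h₂le : ∀ ⦃F : (V → S) → ℝ⦄ ⦃M : ℝ⦄, Measurable F → (∃ B, ∀ σ, |F σ| ≤ B) →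
      DependsOn F (Λ : Set V) → (∀ σ, F σ ≤ M) → (∫ σ, gt σ * F σ ∂μ) / ∫ σ, gt σ ∂μ ≤ M := by
    rintro F M hFm ⟨B, hB⟩ - hM
    rw [div_le_iff₀ hpos]
    calc ∫ σ, gt σ * F σ ∂μ ≤ ∫ σ, gt σ * M ∂μ :=
          integral_mono (hgfi hFm hB) (hgti.mul_const M) fun σ => mul_le_mul_of_nonneg_left (hM σ) (hgt0 σ)
      _ = M * ∫ σ, gt σ ∂μ := by rw [integral_mul_const, mul_comm]
  have h₂ge : ∀ ⦃F : (V → S) → ℝ⦄ ⦃M : ℝ⦄, Measurable F → (∃ B, ∀ σ, |F σ| ≤ B) →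
      DependsOn F (Λ : Set V) → (∀ σ, M ≤ F σ) → M ≤ (∫ σ, gt σ * F σ ∂μ) / ∫ σ, gt σ ∂μ := by
    rintro F M hFm ⟨B, hB⟩ - hM
    rw [le_div_iff₀ hpos]
    calc M * ∫ σ, gt σ ∂μ = ∫ σ, gt σ * M ∂μ := by rw [integral_mul_const, mul_comm]
      _ ≤ ∫ σ, gt σ * F σ ∂μ :=
          integral_mono (hgti.mul_const M) (hgfi hFm hB) fun σ => mul_le_mul_of_nonneg_left (hM σ) (hgt0 σ)
  have h₂T : ∀ c, c ∈ Λ → nbhd c ⊆ Λ → (∀ z ∈ win c, z ∉ Δg) → ∀ ⦃F : (V → S) → ℝ⦄, Measurable F →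
      (∃ B, ∀ σ, |F σ| ≤ B) → DependsOn F (Λ : Set V) →
        (∫ σ, gt σ * (fun σ => ∫ τ, F τ ∂(γ (win c) σ)) σ ∂μ) / ∫ σ, gt σ ∂μ =
          (∫ σ, gt σ * F σ ∂μ) / ∫ σ, gt σ ∂μ := by
    rintro c - - hc F hFm ⟨B, hB⟩ -
    congr 1
    have hmul : ∀ η, gt η * (∫ τ, F τ ∂(γ (win c) η)) = ∫ τ, gt τ * F τ ∂(γ (win c) η) := fun η =>
      mul_windowAvg_eq_of_dependsOn hγ (cell := id) (Λ := win c) (W := win c) (fun v => Iff.rfl)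
        (g := gt) (Δg := Δg) hgtdep hc F η
    simp_rw [hmul]
    exact hμ.integral_integral_eq hγ (win c) (hgfi hFm hB)
  -- the geometric comparison theorem for `f` with its Lipschitz vector cut down to `Δf`
  have hfdepΛ : DependsOn f (Λ : Set V) :=
    hfdep.mono fun v hv => Finset.mem_coe.2 (hΔf (Finset.mem_coe.1 hv))
  have hδL : ∀ x, ℓ x < L₀ → (fun x => if x ∈ Δf then δf x else 0) x = 0 := fun x hx => by
    dsimp only
    split_ifs with hxΔ
    · exact absurd (hL x hxΔ) (not_le.2 hx)
    · rfl
  have key := abs_sub_le_of_window_geometric_exp hγ hr0 hrR hR hK0 hself hwin hKsupp hcontract hloc hγ₀ hγ₁ hsum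
    Λ τ₀ (fun c => ∀ z ∈ win c, z ∉ Δg) (E₁ := fun F => ∫ σ, F σ ∂μ)
    (E₂ := fun F => (∫ σ, gt σ * F σ ∂μ) / ∫ σ, gt σ ∂μ) h₁le h₁ge h₁T h₂le h₂ge h₂T ℓ L₀ hU hℓ
    hfm hBf hfdepΛ (hδf.restrict hfdep) hδL
  have hs : ∑ x ∈ Λ, (if x ∈ Δf then δf x else 0) = ∑ x ∈ Δf, δf x := by
    rw [Finset.sum_ite_mem, Finset.inter_eq_right.2 hΔf]
  rw [hs] at key
  change |∫ σ, f σ ∂μ - (∫ σ, gt σ * f σ ∂μ) / ∫ σ, gt σ ∂μ| ≤ R * γ₀ ^ L₀ * ∑ x ∈ Δf, δf x at key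
  -- `cov = μ(g̃) · (μ_{g̃}(f) - μ(f))`
  have hfgt : ∫ σ, f σ * gt σ ∂μ = ∫ σ, gt σ * f σ ∂μ :=
    integral_congr_ae (ae_of_all _ fun σ => mul_comm _ _)
  have hident : cov[f, g; μ] =
      (∫ σ, gt σ ∂μ) * ((∫ σ, gt σ * f σ ∂μ) / ∫ σ, gt σ ∂μ - ∫ σ, f σ ∂μ) := by
    rw [hcov, hfgt, mul_sub, mul_div_cancel₀ _ hz]
    ring
  rw [hident, abs_mul, abs_of_pos hpos, abs_sub_comm]
  have hgtint : ∫ σ, gt σ ∂μ ≤ 2 * Sg := by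
    calc ∫ σ, gt σ ∂μ ≤ ∫ _σ, 2 * Sg ∂μ := integral_mono hgti (integrable_const _) hgtB
      _ = 2 * Sg := by simp
  have hexp : 0 ≤ R * γ₀ ^ L₀ * ∑ x ∈ Δf, δf x := by
    have := Finset.sum_nonneg fun x (_ : x ∈ Δf) => hδf.nonneg x
    have := pow_nonneg hγ₀ L₀
    positivity
  calc (∫ σ, gt σ ∂μ) * |∫ σ, f σ ∂μ - (∫ σ, gt σ * f σ ∂μ) / ∫ σ, gt σ ∂μ|
      ≤ (2 * Sg) * (R * γ₀ ^ L₀ * ∑ x ∈ Δf, δf x) :=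
        mul_le_mul hgtint key (abs_nonneg _) (by positivity)
    _ = 2 * R ^ 2 * γ₀ ^ L₀ * (∑ x ∈ Δf, δf x) * ∑ y ∈ Δg, δg y := by
        rw [hSg]; ring

/-! ### Two specifications: the comparison WITH DEFECTS, governed by a super-solution -/

/-- **The window comparison of TWO SPECIFICATIONS WITH DEFECTS (Gibbs pairs), governed by a super-solution**
(Föllmer 1988 Ch. I, Comparison Theorem (2.8) with the localised defect (2.10), window form). Window data of `γ`
with the per-window received sum `≤ γ₀ < 1`; `γ'` a second specification whose window kernels at the USABLE centres
(`c ∈ Λ`, `nbhd c ⊆ Λ`, `P c`) differ from those of `γ`, on bounded measurable `Λ`-local observables with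
site-Lipschitz vector `δ`, by at most `Σ_{x ∈ win c} κ c x δ x` (defect array `κ ≥ 0`); `μ ∈ G(γ)`, `ν ∈ G(γ')`; `d ≥ 0` a
super-solution: (S1) `Σ_{y ∈ nbhd c} K c y x d y + κ c x ≤ d x` (usable `c`, `x ∈ win c`), (S2) `R ≤ d x` at the sites of
`Λ` in no usable window. Then for `f` bounded measurable reading `Δf ⊆ Λ` with site-Lipschitz vector `δf`:
`|∫ f dμ − ∫ f dν| ≤ Σ_{x ∈ Δf} d x δf x` — linear in the defect through `d`, decaying along whatever profile `d`
encodes. [cite: Follmer1988, Ch. I Theorem (2.8) and (2.10)] -/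
theorem abs_integral_sub_integral_le_of_window_pair_defect [DecidableEq V] {γ γ' : Specification V S}
    (hγ : IsSpecification γ) (hγ' : IsSpecification γ')
    {r : S → S → ℝ} {R : ℝ} (hr0 : ∀ a b, 0 ≤ r a b) (hrR : ∀ a b, r a b ≤ R) (hR : 0 ≤ R)
    {win nbhd : V → Finset V} {K : V → V → V → ℝ} (hK0 : ∀ c y x, 0 ≤ K c y x)
    (hwin : ∀ c, win c ⊆ nbhd c)
    (hKsupp : ∀ c y x, K c y x ≠ 0 → y ∈ nbhd c)
    (hcontract : ∀ (c y : V), y ∉ win c → ∀ (ω η : V → S), (∀ v, v ≠ y → ω v = η v) →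
      ∀ (f : (V → S) → ℝ) (δ : V → ℝ), Measurable f → (∃ B, ∀ σ, |f σ| ≤ B) →
        DependsOn f (win c : Set V) → (∀ x, 0 ≤ δ x) →
        (∀ (x : V) (σ τ : V → S), (∀ v, v ≠ x → σ v = τ v) → |f σ - f τ| ≤ δ x * r (σ x) (τ x)) →
          |∫ σ, f σ ∂(γ (win c) ω) - ∫ σ, f σ ∂(γ (win c) η)| ≤
            (∑ x ∈ win c, K c y x * δ x) * r (ω y) (η y))
    (hloc : ∀ (c : V) (ζ ζ' : V → S), (∀ v ∈ nbhd c, ζ v = ζ' v) →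
      ∀ (f : (V → S) → ℝ), Measurable f → (∃ B, ∀ σ, |f σ| ≤ B) → DependsOn f (win c : Set V) →
        ∫ σ, f σ ∂(γ (win c) ζ) = ∫ σ, f σ ∂(γ (win c) ζ'))
    {γ₀ : ℝ} (hγ₀ : 0 ≤ γ₀) (hγ₁ : γ₀ < 1)
    (hsum : ∀ c, ∀ x ∈ win c, ∑ y ∈ nbhd c, K c y x ≤ γ₀)
    {μ ν : Measure (V → S)} (hμ : IsGibbsMeasure γ μ) (hν : IsGibbsMeasure γ' ν) (Λ : Finset V) (P : V → Prop)
    {κ : V → V → ℝ} (hκ0 : ∀ c x, 0 ≤ κ c x)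
    (hdefect : ∀ c, c ∈ Λ → nbhd c ⊆ Λ → P c → ∀ (σ : V → S) ⦃G : (V → S) → ℝ⦄, Measurable G →
      (∃ B, ∀ τ, |G τ| ≤ B) → DependsOn G (Λ : Set V) → ∀ ⦃δ : V → ℝ⦄, IsLipBound r G δ →
        |∫ τ, G τ ∂(γ (win c) σ) - ∫ τ, G τ ∂(γ' (win c) σ)| ≤ ∑ x ∈ win c, κ c x * δ x)
    {d : V → ℝ} (hd0 : ∀ x, 0 ≤ d x)
    (hdS : ∀ c, c ∈ Λ → nbhd c ⊆ Λ → P c → ∀ x ∈ win c, ∑ y ∈ nbhd c, K c y x * d y + κ c x ≤ d x)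
    (hdR : ∀ x ∈ Λ, (∀ c, c ∈ Λ → nbhd c ⊆ Λ → P c → x ∉ win c) → R ≤ d x)
    {f : (V → S) → ℝ} (hfm : Measurable f) {Bf : ℝ} (hBf : ∀ σ, |f σ| ≤ Bf)
    {Δf : Finset V} (hfdep : DependsOn f (Δf : Set V)) {δf : V → ℝ} (hδf : IsLipBound r f δf)
    (hΔf : Δf ⊆ Λ) :
    |∫ σ, f σ ∂μ - ∫ σ, f σ ∂ν| ≤ ∑ x ∈ Δf, d x * δf x := by
  classical
  haveI := hμ.isProbabilityMeasure
  haveI := hν.isProbabilityMeasure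
  obtain ⟨τ₀, -⟩ := nonempty_of_measure_ne_zero (μ := μ) (s := Set.univ) (by simp)
  -- `E₁ = μ`, `E₂ = ν`: monotone-normalised
  have h₁le : ∀ ⦃F : (V → S) → ℝ⦄ ⦃M : ℝ⦄, Measurable F → (∃ B, ∀ σ, |F σ| ≤ B) →
      DependsOn F (Λ : Set V) → (∀ σ, F σ ≤ M) → ∫ σ, F σ ∂μ ≤ M := by
    rintro F M hFm ⟨B, hB⟩ - hM
    calc ∫ σ, F σ ∂μ ≤ ∫ _σ, M ∂μ := integral_mono (integrable_of_abs_le' hFm hB) (integrable_const M) hM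
      _ = M := by simp
  have h₁ge : ∀ ⦃F : (V → S) → ℝ⦄ ⦃M : ℝ⦄, Measurable F → (∃ B, ∀ σ, |F σ| ≤ B) →
      DependsOn F (Λ : Set V) → (∀ σ, M ≤ F σ) → M ≤ ∫ σ, F σ ∂μ := by
    rintro F M hFm ⟨B, hB⟩ - hM
    calc M = ∫ _σ, M ∂μ := by simp
      _ ≤ ∫ σ, F σ ∂μ := integral_mono (integrable_const M) (integrable_of_abs_le' hFm hB) hM
  have h₁T : ∀ c, c ∈ Λ → nbhd c ⊆ Λ → P c → ∀ ⦃F : (V → S) → ℝ⦄, Measurable F →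
      (∃ B, ∀ σ, |F σ| ≤ B) → DependsOn F (Λ : Set V) →
        ∫ σ, (fun σ => ∫ τ, F τ ∂(γ (win c) σ)) σ ∂μ = ∫ σ, F σ ∂μ := by
    rintro c - - - F hFm ⟨B, hB⟩ -
    exact hμ.integral_integral_eq hγ (win c) (integrable_of_abs_le' hFm hB)
  have h₂le : ∀ ⦃F : (V → S) → ℝ⦄ ⦃M : ℝ⦄, Measurable F → (∃ B, ∀ σ, |F σ| ≤ B) →
      DependsOn F (Λ : Set V) → (∀ σ, F σ ≤ M) → ∫ σ, F σ ∂ν ≤ M := by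
    rintro F M hFm ⟨B, hB⟩ - hM
    calc ∫ σ, F σ ∂ν ≤ ∫ _σ, M ∂ν := integral_mono (integrable_of_abs_le' hFm hB) (integrable_const M) hM
      _ = M := by simp
  have h₂ge : ∀ ⦃F : (V → S) → ℝ⦄ ⦃M : ℝ⦄, Measurable F → (∃ B, ∀ σ, |F σ| ≤ B) →
      DependsOn F (Λ : Set V) → (∀ σ, M ≤ F σ) → M ≤ ∫ σ, F σ ∂ν := by
    rintro F M hFm ⟨B, hB⟩ - hM
    calc M = ∫ _σ, M ∂ν := by simp
      _ ≤ ∫ σ, F σ ∂ν := integral_mono (integrable_const M) (integrable_of_abs_le' hFm hB) hM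
  -- the defect of `E₂ = ν` under the window kernels of `γ`: DLR for `γ'`, then the kernel defect pointwise
  have h₂D : ∀ c, c ∈ Λ → nbhd c ⊆ Λ → P c → ∀ ⦃G : (V → S) → ℝ⦄, Measurable G →
      (∃ B, ∀ σ, |G σ| ≤ B) → DependsOn G (Λ : Set V) → ∀ ⦃δ : V → ℝ⦄, IsLipBound r G δ →
        |∫ σ, (fun σ => ∫ τ, G τ ∂(γ (win c) σ)) σ ∂ν - ∫ σ, G σ ∂ν| ≤ ∑ x ∈ win c, κ c x * δ x := by
    intro c hc hn hP G hGm hGb hGdep δ hδ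
    obtain ⟨B, hB⟩ := hGb
    have hdlr : ∫ σ, G σ ∂ν = ∫ σ, (∫ τ, G τ ∂(γ' (win c) σ)) ∂ν :=
      (hν.integral_integral_eq hγ' (win c) (integrable_of_abs_le' hGm hB)).symm
    rw [hdlr]
    have hi₁ : Integrable (fun σ => ∫ τ, G τ ∂(γ (win c) σ)) ν :=
      integrable_of_abs_le' (measurable_windowAvg' hγ (win c) hGm) (fun σ => abs_windowAvg_le' hγ (win c) hB σ)
    have hi₂ : Integrable (fun σ => ∫ τ, G τ ∂(γ' (win c) σ)) ν :=
      integrable_of_abs_le' (measurable_windowAvg' hγ' (win c) hGm) (fun σ => abs_windowAvg_le' hγ' (win c) hB σ)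
    rw [← integral_sub hi₁ hi₂]
    calc |∫ σ, ((∫ τ, G τ ∂(γ (win c) σ)) - ∫ τ, G τ ∂(γ' (win c) σ)) ∂ν|
        ≤ ∫ σ, |(∫ τ, G τ ∂(γ (win c) σ)) - ∫ τ, G τ ∂(γ' (win c) σ)| ∂ν := abs_integral_le_integral_abs
      _ ≤ ∫ _σ, (∑ x ∈ win c, κ c x * δ x) ∂ν :=
          integral_mono (hi₁.sub hi₂).abs (integrable_const _) fun σ => hdefect c hc hn hP σ hGm ⟨B, hB⟩ hGdep hδ
      _ = ∑ x ∈ win c, κ c x * δ x := by simp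
  -- the super-solution comparison for `f`, with its Lipschitz vector cut down to `Δf`
  have hfdepΛ : DependsOn f (Λ : Set V) :=
    hfdep.mono fun v hv => Finset.mem_coe.2 (hΔf (Finset.mem_coe.1 hv))
  have key := abs_sub_le_of_window_superSolution hγ hr0 hrR hR hK0 hwin hKsupp hcontract hloc hγ₀ hγ₁ hsum Λ τ₀ P
    (E₁ := fun F => ∫ σ, F σ ∂μ) (E₂ := fun F => ∫ σ, F σ ∂ν) h₁le h₁ge h₁T h₂le h₂ge hκ0 h₂D hd0 hdS hdR
    hfm hBf hfdepΛ (hδf.restrict hfdep)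
  have hs : ∑ x ∈ Λ, d x * (if x ∈ Δf then δf x else 0) = ∑ x ∈ Δf, d x * δf x := by
    have h1 : ∑ x ∈ Λ, d x * (if x ∈ Δf then δf x else 0) = ∑ x ∈ Λ, (if x ∈ Δf then d x * δf x else 0) :=
      Finset.sum_congr rfl fun x _ => by split_ifs <;> simp
    rw [h1, Finset.sum_ite_mem, Finset.inter_eq_right.2 hΔf]
  rw [hs] at key
  exact key

/-- **Two specifications agreeing at the usable centres, GEOMETRIC rate** (the defect-free case of
`abs_integral_sub_integral_le_of_window_pair_defect`; compare `abs_integral_sub_integral_le_of_window_pair` with the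
three-zone rate): with a profile `ℓ` as in `abs_sub_le_of_window_geometric` (windows through sites of positive profile
usable, `ℓ` drops by at most one along the support of `K`) and `ℓ ≥ L₀` on `Δf`:
`|∫ f dμ − ∫ f dν| ≤ R γ₀^{L₀} Σ_{x ∈ Δf} δf x`. [cite: Follmer1988, Ch. I Theorem (2.8) and (2.10)] -/
theorem abs_integral_sub_integral_le_of_window_pair_geometric [DecidableEq V] {γ γ' : Specification V S}
    (hγ : IsSpecification γ) (hγ' : IsSpecification γ')
    {r : S → S → ℝ} {R : ℝ} (hr0 : ∀ a b, 0 ≤ r a b) (hrR : ∀ a b, r a b ≤ R) (hR : 0 ≤ R)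
    {win nbhd : V → Finset V} {K : V → V → V → ℝ} (hK0 : ∀ c y x, 0 ≤ K c y x)
    (hself : ∀ c, c ∈ win c) (hwin : ∀ c, win c ⊆ nbhd c)
    (hKsupp : ∀ c y x, K c y x ≠ 0 → y ∈ nbhd c)
    (hcontract : ∀ (c y : V), y ∉ win c → ∀ (ω η : V → S), (∀ v, v ≠ y → ω v = η v) →
      ∀ (f : (V → S) → ℝ) (δ : V → ℝ), Measurable f → (∃ B, ∀ σ, |f σ| ≤ B) →
        DependsOn f (win c : Set V) → (∀ x, 0 ≤ δ x) →
        (∀ (x : V) (σ τ : V → S), (∀ v, v ≠ x → σ v = τ v) → |f σ - f τ| ≤ δ x * r (σ x) (τ x)) →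
          |∫ σ, f σ ∂(γ (win c) ω) - ∫ σ, f σ ∂(γ (win c) η)| ≤
            (∑ x ∈ win c, K c y x * δ x) * r (ω y) (η y))
    (hloc : ∀ (c : V) (ζ ζ' : V → S), (∀ v ∈ nbhd c, ζ v = ζ' v) →
      ∀ (f : (V → S) → ℝ), Measurable f → (∃ B, ∀ σ, |f σ| ≤ B) → DependsOn f (win c : Set V) →
        ∫ σ, f σ ∂(γ (win c) ζ) = ∫ σ, f σ ∂(γ (win c) ζ'))
    {γ₀ : ℝ} (hγ₀ : 0 ≤ γ₀) (hγ₁ : γ₀ < 1)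
    (hsum : ∀ c, ∀ x ∈ win c, ∑ y ∈ nbhd c, K c y x ≤ γ₀)
    {μ ν : Measure (V → S)} (hμ : IsGibbsMeasure γ μ) (hν : IsGibbsMeasure γ' ν) (P : V → Prop)
    (hagree : ∀ c, P c → ∀ (σ : V → S) ⦃G : (V → S) → ℝ⦄, Measurable G → (∃ B, ∀ τ, |G τ| ≤ B) →
      ∫ τ, G τ ∂(γ' (win c) σ) = ∫ τ, G τ ∂(γ (win c) σ))
    {f : (V → S) → ℝ} (hfm : Measurable f) {Bf : ℝ} (hBf : ∀ σ, |f σ| ≤ Bf)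
    {Δf : Finset V} (hfdep : DependsOn f (Δf : Set V)) {δf : V → ℝ} (hδf : IsLipBound r f δf)
    (Λ : Finset V) (hΔf : Δf ⊆ Λ) (ℓ : V → ℕ) (L₀ : ℕ)
    (hU : ∀ x, ℓ x ≠ 0 → ∀ c, x ∈ win c → c ∈ Λ ∧ nbhd c ⊆ Λ ∧ P c)
    (hℓ : ∀ c x y, x ∈ win c → K c y x ≠ 0 → ℓ x ≤ ℓ y + 1) (hL : ∀ x ∈ Δf, L₀ ≤ ℓ x) :
    |∫ σ, f σ ∂μ - ∫ σ, f σ ∂ν| ≤ R * γ₀ ^ L₀ * ∑ x ∈ Δf, δf x := by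
  -- the defect-free super-solution `R γ₀^{ℓ}`
  have key := abs_integral_sub_integral_le_of_window_pair_defect hγ hγ' hr0 hrR hR hK0 hwin hKsupp hcontract hloc hγ₀
    hγ₁ hsum hμ hν Λ P (κ := fun _ _ => 0) (fun _ _ => le_rfl)
    (fun c _ _ hP σ G hGm hGb _ δ hδ => by
      rw [hagree c hP σ hGm hGb, sub_self, abs_zero]
      exact Finset.sum_nonneg fun x _ => mul_nonneg le_rfl (hδ.nonneg x))
    (d := fun x => R * γ₀ ^ ℓ x) (fun x => mul_nonneg hR (pow_nonneg hγ₀ _)) ?_ ?_ hfm hBf hfdep hδf hΔf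
  · refine key.trans ?_
    rw [Finset.mul_sum]
    refine Finset.sum_le_sum fun x hx => ?_
    have h1 : γ₀ ^ ℓ x ≤ γ₀ ^ L₀ := pow_le_pow_of_le_one hγ₀ hγ₁.le (hL x hx)
    have h2 := hδf.nonneg x
    calc R * γ₀ ^ ℓ x * δf x ≤ R * γ₀ ^ L₀ * δf x := by gcongr
      _ = R * γ₀ ^ L₀ * δf x := rfl
  · -- (S1)
    intro c _ _ _ x hxc
    rw [add_zero]
    have hterm : ∀ y, K c y x * (R * γ₀ ^ ℓ y) ≤ K c y x * (R * γ₀ ^ (ℓ x - 1)) := fun y => by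
      by_cases hk0 : K c y x = 0
      · rw [hk0, zero_mul, zero_mul]
      · refine mul_le_mul_of_nonneg_left (mul_le_mul_of_nonneg_left ?_ hR) (hK0 c y x)
        exact pow_le_pow_of_le_one hγ₀ hγ₁.le (by have := hℓ c x y hxc hk0; omega)
    calc ∑ y ∈ nbhd c, K c y x * (R * γ₀ ^ ℓ y) ≤ ∑ y ∈ nbhd c, K c y x * (R * γ₀ ^ (ℓ x - 1)) :=
          Finset.sum_le_sum fun y _ => hterm y
      _ = (∑ y ∈ nbhd c, K c y x) * (R * γ₀ ^ (ℓ x - 1)) := by rw [Finset.sum_mul]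
      _ ≤ γ₀ * (R * γ₀ ^ (ℓ x - 1)) := mul_le_mul_of_nonneg_right (hsum c x hxc) (by positivity)
      _ ≤ R * γ₀ ^ ℓ x := by
          rcases Nat.eq_zero_or_pos (ℓ x) with h0 | hpos
          · rw [h0]; simp only [Nat.zero_sub, pow_zero, mul_one]; nlinarith
          · have : γ₀ * γ₀ ^ (ℓ x - 1) = γ₀ ^ ℓ x := by
              rw [← pow_succ']; congr 1; omega
            rw [← mul_assoc, mul_comm γ₀ R, mul_assoc, this]
  · -- (S2)
    intro x _ hx
    have hx0 : ℓ x = 0 := by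
      by_contra h
      obtain ⟨hcΛ, hcn, hPc⟩ := hU x h x (hself x)
      exact hx x hcΛ hcn hPc (hself x)
    rw [hx0, pow_zero, mul_one]

end Literature.Probability.LatticeModels.DobrushinShlosman

end
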